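import Mathlib.Analysis.Complex.TaylorSeries
import Mathlib.Analysis.Complex.Liouville
import Mathlib.Analysis.SpecialFunctions.Integrals.Basic
import Mathlib.MeasureTheory.Integral.IntervalIntegral.Basic

/-!
# RiemannHypothesis / UniversalFactor — certified quadrature of analytic functions along a segment

Route `RiemannHypothesis/UniversalFactor`, item `LehmerPointNoGo` (stmt-RiemannHypothesis-2582).
The certificate for `LehmerPointNoGo` integrates `t ↦ ξ(½ + it) e^{−32|t − t₀|}` over short
segments from finitely many certified values of `ζ(½ + it)`.  This file proves the error bound that
turns a finite weighted sum of point values into an enclosure of the integral, for ANY nodes and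
weights, using only a sup bound of the integrand on a larger disc (no interpolation theory):

* `UniversalFactor.quadrature_error_le` — if `f` is holomorphic on `ball c R₁`, `‖f‖ ≤ M` on the
  circle `sphere c R` (`ρ < R < R₁`), the nodes `u j` lie in `[−ρ, ρ]` and `W j` are real weights,
  then for every `K`
  `‖∫_{−ρ}^{ρ} f(c + ix) dx − Σ_j W_j f(c + i u_j)‖ ≤
     M (Σ_{n ≤ K} η_n / Rⁿ + (2ρ + Σ_j |W_j|) q^{K+1}/(1 − q))`,
  `q = ρ/R`, where `η_n = |∫_{−ρ}^{ρ} xⁿ dx − Σ_j W_j u_jⁿ|` is the (exactly computable, rational for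
  rational data) defect of exactness of the rule on the monomial `xⁿ`.

Proof: Taylor expansion at `c` (`Complex.hasSum_taylorSeries_on_ball`) with Cauchy's estimate
`‖f⁽ⁿ⁾(c)‖/n! ≤ M/Rⁿ` (`Complex.norm_iteratedDeriv_le_of_forall_mem_sphere_norm_le`): the rule is
applied exactly to the Taylor polynomial of degree `K` (error `Σ ‖aₙ‖ ηₙ`) and crudely to the
remainder, which is `≤ M q^{K+1}/(1−q)` on the segment.

References: P. J. Davis, P. Rabinowitz, *Methods of Numerical Integration*, 2nd ed. (1984), §4.6
(errors of interpolatory rules for analytic functions); folklore.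
-/

noncomputable section

set_option linter.dupNamespace false

namespace Summit.RiemannHypothesis.RiemannHypothesis.Theorems

open Complex MeasureTheory intervalIntegral Metric Set Finset
open scoped Nat

/-- **Quadrature error for analytic functions along a vertical segment.** Let `f` be holomorphic on
`ball c R₁`, `‖f z‖ ≤ M` for `z ∈ sphere c R` with `0 ≤ ρ < R < R₁`, let `u j ∈ [−ρ, ρ]` be nodes and
`W j` real weights (`j ∈ s`). Then for every `K : ℕ`,
`‖∫_{−ρ}^{ρ} f(c + ix) dx − Σ_j W_j f(c + i u_j)‖ ≤
  M · (Σ_{n ≤ K} |∫_{−ρ}^{ρ} xⁿ − Σ_j W_j u_jⁿ| / Rⁿ + (2ρ + Σ_j |W_j|) · q^{K+1}/(1 − q))`, `q = ρ/R`.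
[folklore] -/
theorem UniversalFactor.quadrature_error_le {f : ℂ → ℂ} {c : ℂ} {R R₁ ρ M : ℝ}
    (hρ : 0 ≤ ρ) (hρR : ρ < R) (hRR₁ : R < R₁)
    (hf : DifferentiableOn ℂ f (ball c R₁)) (hM : ∀ z ∈ sphere c R, ‖f z‖ ≤ M)
    {ι : Type*} (s : Finset ι) (u W : ι → ℝ) (hu : ∀ j ∈ s, |u j| ≤ ρ) (K : ℕ) :
    ‖(∫ x in (-ρ)..ρ, f (c + (x : ℂ) * I)) - ∑ j ∈ s, (W j : ℂ) * f (c + (u j : ℂ) * I)‖ ≤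
      M * (∑ n ∈ range (K + 1),
              |((ρ ^ (n + 1) - (-ρ) ^ (n + 1)) / (n + 1) - ∑ j ∈ s, W j * u j ^ n)| / R ^ n
           + (2 * ρ + ∑ j ∈ s, |W j|) * ((ρ / R) ^ (K + 1) / (1 - ρ / R))) := by
  have hR : 0 < R := lt_of_le_of_lt hρ hρR
  have hR₁ : 0 < R₁ := hR.trans hRR₁
  -- `M ≥ 0`
  have hM0 : 0 ≤ M := by
    have hz : c + R ∈ sphere c R := by simp [hR.le]
    exact (norm_nonneg _).trans (hM _ hz)
  set q : ℝ := ρ / R with hq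
  have hq0 : 0 ≤ q := by positivity
  have hq1 : q < 1 := by rw [hq, div_lt_one hR]; exact hρR
  -- Cauchy's estimate for the Taylor coefficients `a n = f⁽ⁿ⁾(c)/n!`
  have hdc : DiffContOnCl ℂ f (ball c R) := by
    refine ⟨hf.mono (ball_subset_ball hRR₁.le), ?_⟩
    exact (hf.mono (closure_ball_subset_closedBall.trans (closedBall_subset_ball hRR₁))).continuousOn
  set a : ℕ → ℂ := fun n => (n ! : ℂ)⁻¹ * iteratedDeriv n f c with ha_def
  have ha : ∀ n, ‖a n‖ ≤ M / R ^ n := by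
    intro n
    have h := Complex.norm_iteratedDeriv_le_of_forall_mem_sphere_norm_le n hR hdc hM
    have hfac : (0 : ℝ) < n ! := by exact_mod_cast Nat.factorial_pos n
    rw [ha_def]
    simp only [norm_mul, norm_inv, Complex.norm_natCast]
    rw [inv_mul_le_iff₀ hfac]
    calc ‖iteratedDeriv n f c‖ ≤ n ! * M / R ^ n := h
      _ = (n ! : ℝ) * (M / R ^ n) := by ring
  -- Taylor polynomial and remainder bound on the closed disc of radius `ρ`
  set T : ℂ → ℂ := fun w => ∑ n ∈ range (K + 1), w ^ n * a n with hT_def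
  set B : ℝ := M * (q ^ (K + 1) / (1 - q)) with hB_def
  have hB0 : 0 ≤ B := by
    have : 0 < 1 - q := by linarith
    positivity
  have hrem : ∀ w : ℂ, ‖w‖ ≤ ρ → ‖f (c + w) - T w‖ ≤ B := by
    intro w hw
    have hz : c + w ∈ ball c R₁ := by
      rw [mem_ball, dist_eq_norm, add_sub_cancel_left]
      linarith
    have hsum : HasSum (fun n : ℕ => w ^ n * a n) (f (c + w)) := by
      have h := Complex.hasSum_taylorSeries_on_ball hf hz
      simp only [add_sub_cancel_left, smul_eq_mul] at h
      have hfun : (fun n : ℕ => (n ! : ℂ)⁻¹ * ((w ^ n) * iteratedDeriv n f c)) =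
          fun n : ℕ => w ^ n * a n := by
        funext n
        simp only [ha_def]
        ring
      rw [hfun] at h
      exact h
    have htail : HasSum (fun n : ℕ => w ^ (n + (K + 1)) * a (n + (K + 1)))
        (f (c + w) - T w) := by
      have := (hasSum_nat_add_iff' (K + 1)).2 hsum
      simpa [hT_def] using this
    have hgeo : HasSum (fun n : ℕ => M * q ^ (K + 1) * q ^ n) (M * q ^ (K + 1) * (1 - q)⁻¹) :=
      (hasSum_geometric_of_lt_one hq0 hq1).mul_left _
    have hle := htail.norm_le_of_bounded hgeo fun n => by
      rw [norm_mul, norm_pow]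
      have hwn : ‖w‖ ^ (n + (K + 1)) ≤ ρ ^ (n + (K + 1)) := pow_le_pow_left₀ (norm_nonneg _) hw _
      calc ‖w‖ ^ (n + (K + 1)) * ‖a (n + (K + 1))‖
          ≤ ρ ^ (n + (K + 1)) * (M / R ^ (n + (K + 1))) :=
            mul_le_mul hwn (ha _) (norm_nonneg _) (pow_nonneg hρ _)
        _ = M * q ^ (K + 1) * q ^ n := by
            rw [hq, mul_assoc, ← pow_add, add_comm (K + 1) n, div_pow]
            field_simp
    calc ‖f (c + w) - T w‖ ≤ M * q ^ (K + 1) * (1 - q)⁻¹ := hle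
      _ = B := by rw [hB_def]; ring
  -- the integrand along the segment and its remainder
  have hcont : ContinuousOn (fun x : ℝ => f (c + (x : ℂ) * I)) (Set.uIcc (-ρ) ρ) := by
    have hmap : ∀ x ∈ Set.uIcc (-ρ) ρ, c + (x : ℂ) * I ∈ ball c R₁ := by
      intro x hx
      rw [Set.uIcc_of_le (by linarith), Set.mem_Icc] at hx
      rw [mem_ball, dist_eq_norm, add_sub_cancel_left, norm_mul, Complex.norm_I, mul_one,
        Complex.norm_real, Real.norm_eq_abs]
      have : |x| ≤ ρ := abs_le.2 ⟨hx.1, hx.2⟩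
      linarith
    refine hf.continuousOn.comp ?_ hmap
    fun_prop
  have hTcont : Continuous fun x : ℝ => T ((x : ℂ) * I) := by
    simp only [hT_def]
    fun_prop
  have hint_f : IntervalIntegrable (fun x : ℝ => f (c + (x : ℂ) * I)) volume (-ρ) ρ :=
    hcont.intervalIntegrable
  have hint_T : IntervalIntegrable (fun x : ℝ => T ((x : ℂ) * I)) volume (-ρ) ρ :=
    hTcont.intervalIntegrable _ _
  -- the rule applied to the monomials: `T (x I) = Σ_n (I^n a_n) x^n`
  have hTx : ∀ x : ℝ, T ((x : ℂ) * I) = ∑ n ∈ range (K + 1), (I ^ n * a n) * ((x ^ n : ℝ) : ℂ) := by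
    intro x
    simp only [hT_def]
    refine sum_congr rfl fun n _ => ?_
    push_cast
    ring
  have hintT : ∫ x in (-ρ)..ρ, T ((x : ℂ) * I) =
      ∑ n ∈ range (K + 1), (I ^ n * a n) * (((ρ ^ (n + 1) - (-ρ) ^ (n + 1)) / (n + 1) : ℝ) : ℂ) := by
    simp_rw [hTx]
    rw [intervalIntegral.integral_finsetSum]
    · refine sum_congr rfl fun n _ => ?_
      rw [intervalIntegral.integral_const_mul, intervalIntegral.integral_ofReal, integral_pow]
    · intro n _
      exact (by fun_prop : Continuous fun x : ℝ => (I ^ n * a n) * ((x ^ n : ℝ) : ℂ)).intervalIntegrable _ _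
  have hsumT : ∑ j ∈ s, (W j : ℂ) * T ((u j : ℂ) * I) =
      ∑ n ∈ range (K + 1), (I ^ n * a n) * ((∑ j ∈ s, W j * u j ^ n : ℝ) : ℂ) := by
    simp_rw [hTx, mul_sum]
    rw [sum_comm]
    refine sum_congr rfl fun n _ => ?_
    push_cast
    rw [mul_sum]
    refine sum_congr rfl fun j _ => ?_
    ring
  -- split the error into the polynomial part and the remainder part
  set e : ℕ → ℝ := fun n => (ρ ^ (n + 1) - (-ρ) ^ (n + 1)) / (n + 1) - ∑ j ∈ s, W j * u j ^ n
    with he_def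
  have hpoly : (∫ x in (-ρ)..ρ, T ((x : ℂ) * I)) - ∑ j ∈ s, (W j : ℂ) * T ((u j : ℂ) * I) =
      ∑ n ∈ range (K + 1), (I ^ n * a n) * ((e n : ℝ) : ℂ) := by
    rw [hintT, hsumT, ← sum_sub_distrib]
    refine sum_congr rfl fun n _ => ?_
    rw [he_def]
    push_cast
    ring
  have hpoly_le : ‖(∫ x in (-ρ)..ρ, T ((x : ℂ) * I)) - ∑ j ∈ s, (W j : ℂ) * T ((u j : ℂ) * I)‖ ≤
      M * ∑ n ∈ range (K + 1), |e n| / R ^ n := by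
    rw [hpoly, mul_sum]
    refine (norm_sum_le _ _).trans (sum_le_sum fun n _ => ?_)
    rw [norm_mul, norm_mul, norm_pow, Complex.norm_I, one_pow, one_mul, Complex.norm_real,
      Real.norm_eq_abs]
    calc ‖a n‖ * |e n| ≤ M / R ^ n * |e n| := mul_le_mul_of_nonneg_right (ha n) (abs_nonneg _)
      _ = M * (|e n| / R ^ n) := by ring
  -- remainder part
  have hrem_x : ∀ x : ℝ, |x| ≤ ρ → ‖f (c + (x : ℂ) * I) - T ((x : ℂ) * I)‖ ≤ B := by
    intro x hx
    refine hrem ((x : ℂ) * I) ?_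
    rw [norm_mul, Complex.norm_I, mul_one, Complex.norm_real, Real.norm_eq_abs]
    exact hx
  have hrem_int : ‖(∫ x in (-ρ)..ρ, f (c + (x : ℂ) * I)) - ∫ x in (-ρ)..ρ, T ((x : ℂ) * I)‖ ≤
      2 * ρ * B := by
    rw [← intervalIntegral.integral_sub hint_f hint_T]
    have h := intervalIntegral.norm_integral_le_of_norm_le_const (a := -ρ) (b := ρ) (C := B)
      (f := fun x : ℝ => f (c + (x : ℂ) * I) - T ((x : ℂ) * I)) ?_
    · calc _ ≤ B * |ρ - -ρ| := h
        _ = 2 * ρ * B := by rw [sub_neg_eq_add, abs_of_nonneg (by linarith)]; ring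
    · intro x hx
      rw [Set.uIoc_of_le (by linarith), Set.mem_Ioc] at hx
      exact hrem_x x (abs_le.2 ⟨hx.1.le, hx.2⟩)
  have hrem_sum : ‖∑ j ∈ s, (W j : ℂ) * f (c + (u j : ℂ) * I) - ∑ j ∈ s, (W j : ℂ) * T ((u j : ℂ) * I)‖ ≤
      (∑ j ∈ s, |W j|) * B := by
    rw [← sum_sub_distrib, sum_mul]
    refine (norm_sum_le _ _).trans (sum_le_sum fun j hj => ?_)
    rw [← mul_sub, norm_mul, Complex.norm_real, Real.norm_eq_abs]
    exact mul_le_mul_of_nonneg_left (hrem_x _ (hu j hj)) (abs_nonneg _)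
  -- assemble
  have key : (∫ x in (-ρ)..ρ, f (c + (x : ℂ) * I)) - ∑ j ∈ s, (W j : ℂ) * f (c + (u j : ℂ) * I) =
      ((∫ x in (-ρ)..ρ, T ((x : ℂ) * I)) - ∑ j ∈ s, (W j : ℂ) * T ((u j : ℂ) * I)) +
      (((∫ x in (-ρ)..ρ, f (c + (x : ℂ) * I)) - ∫ x in (-ρ)..ρ, T ((x : ℂ) * I)) -
       (∑ j ∈ s, (W j : ℂ) * f (c + (u j : ℂ) * I) - ∑ j ∈ s, (W j : ℂ) * T ((u j : ℂ) * I))) := by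
    ring
  rw [key]
  refine (norm_add_le _ _).trans ?_
  refine (add_le_add hpoly_le ((norm_sub_le _ _).trans (add_le_add hrem_int hrem_sum))).trans ?_
  rw [hB_def, he_def]
  exact le_of_eq (by ring)

end Summit.RiemannHypothesis.RiemannHypothesis.Theorems
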